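import Mathlib
import HarnessLib
import HarnessLib.Audit
import Summits.HubbardSuperconductivity.Statement
import HarnessLib.Audit.Status.Attr

/-!
Route: IsoperimetricCascade

DORMANT since 2026-08-25T14:01:13Z (reconciler: no traction for 7.8 d (last activity item-evidence-added at 2026-08-17T19:16:30Z); parked, not closed — `ledger route dormant route-HubbardSuperconductivity-IsoperimetricCascade --off` to ) — unstaffed, not closed; items shared with open routes are served there. `ledger route dormant <id> --off` reactivates.

# Route IsoperimetricCascade — isoperimetry of pairing — the K-th root of the flat-AGP overlap plus
a parameter-free depletion-cascade inequality floor the d-wave pair field of every ground state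

X = IsoCascade ("it suffices to show X"): there is ONE point (U, δ), U > 0, δ ∈ (0,1/2), a spectator
number r, constants
C, γ and L₀ such that for every even L ≥ L₀ EVERY normalised ground state ψ of hubbardTorus 2 L 1 U
in the
(N_L = 2K, S^z = 0) sector, K = ⌊(1−δ)L²/2⌋, satisfies — with Δ := pairField dWaveFormFactor L (= √2
Δ_d),
μ_k(ψ) := ‖Δ^k ψ‖² (the d-wave DEPLETION CASCADE of ψ) and n := K − r — both (X1, CASCADE CRITERION)
μ_n(ψ) ≤ e^{Cn} μ_1(ψ)^n and (X2, OVERLAP RATE) μ_n(ψ) ≥ e^{−γL²} ‖(Δᴴ)^n|0⟩‖². Card realised: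
isoperimetric-pair-cascade (its K1 = IsoperimetricInequality gives X1 at the witness point with C =
1, its K2 =
OverlapRate gives X2 on the whole window [2,8]×[1/10,2/5]). Because ‖(Δᴴ)^n|0⟩‖² = 2^n (n!)²
e_n(|ĝ_d|²) ≥ (κ_δ L⁴)^n
(support FlatAGPNormGrowth, Coleman's geminal-power norm — the 'volume' end of the cascade), the
n-th ROOT of X1·X2
is an intensive floor μ_1 = ⟨ψ, ΔᴴΔ ψ⟩ ≥ e^{−C−4γ⁺/(1−δ)} κ_δ L⁴ for every ground state (support
CascadeToFloor →
PairFieldFloor), which is the summit at (U, δ) (support FloorToSummit).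
Lean: `∃ U : ℝ, 0 < U ∧ ∃ δ ∈ Set.Ioo (0:ℝ) (1/2), ∃ r : ℕ, ∃ C : ℝ, ∃ γ : ℝ, ∃ L₀ : ℕ, ∀ (L : ℕ)
[NeZero L], L₀ ≤ L → Even L → ∀ ψ : Literature.MathematicalPhysics.QuantumLattice.Fock
(Literature.MathematicalPhysics.QuantumLattice.Orb
(Literature.MathematicalPhysics.QuantumLattice.FermionTorus 2 L)), star ψ ⬝ᵥ ψ = 1 →
Literature.MathematicalPhysics.QuantumLattice.IsGroundStateInSector
(Literature.MathematicalPhysics.QuantumLattice.hubbardTorus 2 L 1 U) (2 * ⌊(1 - δ) * (L : ℝ) ^ 2 /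
2⌋₊) 0 ψ → let Δ := Literature.MathematicalPhysics.QuantumLattice.pairField
Literature.MathematicalPhysics.QuantumLattice.dWaveFormFactor L; let n := ⌊(1 - δ) * (L : ℝ) ^ 2 /
2⌋₊ - r; let Φ := Δᴴ ^ n *ᵥ Literature.MathematicalPhysics.QuantumLattice.vacuum; (star (Δ ^ n *ᵥ ψ)
⬝ᵥ (Δ ^ n *ᵥ ψ)).re ≤ Real.exp (C * n) * (star (Δ *ᵥ ψ) ⬝ᵥ (Δ *ᵥ ψ)).re ^ n ∧ Real.exp (-(γ * (L :
ℝ) ^ 2)) * (star Φ ⬝ᵥ Φ).re ≤ (star (Δ ^ n *ᵥ ψ) ⬝ᵥ (Δ ^ n *ᵥ ψ)).re`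

## Assembly
Pure logic (theorem `closes` in glue.lean; kernel-checked in the planner's Sketch.lean next to
cruxesGiveCascade_proof):
FloorToSummit (CascadeToFloor FlatAGPNormGrowth (CruxesGiveCascade IsoperimetricInequality
OverlapRate)) : HubbardSuperconductivity.
All mathematics sits in the two cruxes and in the provable supports FlatAGPNormGrowth
(momentum-space combinatorics),
CascadeToFloor (n-th roots) and FloorToSummit (even-side liminf bookkeeping); MaclaurinEndpoint and
AttractiveSWaveOverlap are
the provable engine / solvable instance and do not enter `closes`.

Rationale: WHY THIS LINE. Mechanism (card isoperimetric-pair-cascade, audited new-combination): the d-wave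
depletion cascade μ_k = ‖Δ_d^k ψ‖² of ONE
state carries the order parameter at k = 1 and the overlap with Coleman's flat antisymmetrized
geminal power (Δ_d†)^K|0⟩
at k = K (Coleman1965 §§3–5, Yang1962 §4); the transplanted inequality is Minkowski's first /
Maclaurin's endpoint
inequality of Brunn–Minkowski theory (doi:10.1090/s0273-0979-02-00941-2 §§5–7: surface area ≥
volume^{1/n}, here
μ_1 ≥ e^{−C} μ_n^{1/n}) and 'the n-th root of a many-body overlap is intensive' (fidelity per site,
doi:10.1103/physrevlett.100.080601) turns an e^{−γL²}-small overlap into an L⁴ floor. Imported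
areas: convex-geometric
inequalities for log-concave sequences (Newton–Maclaurin), composite-boson normalisation cascades
χ_N = N! e_N(λ) and
their Maclaurin log-concavity (doi:10.1103/physreva.86.042317, doi:10.1103/physrevlett.104.070402,
doi:10.1016/j.physrep.2007.11.003), Dicke superradiance as the obstruction dictionary
(doi:10.1103/physrev.93.99,
doi:10.1103/physrev.112.1900: the Fermi sea is the inverted pseudospin state, its cascade is
superradiant and fails the
criterion exactly by the missing volume factor). What it does that prior routes do not: every other
floor route on this
summit (KkFloor, TwistGap, DeformationLadder, KacWindowPenalty, BcsKacWindow) deforms the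
Hamiltonian and must control an
ENERGY; PlaquetteBoson (monotone-depletion-interpolation) and pair-accretion compare ground states
at DIFFERENT N from a
reflection-positive anchor; ProjectedBCSGas proves order OF a trial state. Here nothing is deformed
and no second state
enters: S at (U,δ) is split into a statement of a new, weak logical type — OverlapRate, 'an overlap
is not
SUPER-exponentially small', provable exactly where positivity lives (support AttractiveSWaveOverlap:
Lieb's W-definiteness,
LiebPRL1989, gives it for the attractive model with s-wave pairs from the tree's proved
lieb_attractive machinery) — and
a PARAMETER-FREE isoperimetric inequality IsoperimetricInequality ('no Dicke superradiance of the
ground state's own pair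
emission, on average along the cascade'). The ∃C form of the criterion is deliberately NOT a crux:
by Yang's bound
‖Δ|_N‖² ≤ cMN it is implied by S itself, so only the parameter-free form carries content beyond S
(it forces
m ≥ κ_δ e^{−4γ/(1−δ)}). The negatives index (1 entry, KLS-order openness under perturbations) is not
touched: no
perturbative stability claim is made anywhere.

RANKED CRUXES. #0 IsoCascade (target) — X of § Thesis — at one (U, δ) with U > 0, δ ∈ (0,1/2), for
some r, C, γ, L₀, every normalised (2K, S^z = 0)-sector ground state at even L ≥ L₀ satisfies the
cascade criterion μ_n ≤ e^{Cn} μ_1^n AND the overlap rate e^{−γL²}‖(Δᴴ)^n|0⟩‖² ≤ μ_n, n = K − r (μ_k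
= ‖Δ^kψ‖², Δ = pairField dWaveFormFactor L, |0⟩ = vacuum). (why it might fail: X1 ∧ X2 at a common
point is at least S-with-a-constant: published pure-model (t'=0) d-wave responses at U ≈ 4–8, δ ≈
1/8–1/5 are stripe-dominated (QinEtAl2020, XuEtAl2024); if the pure model has no d-wave LRO anywhere
in (0,1/2) the target is false with S.) [Coleman1965, Yang1962, QinEtAl2020, XuEtAl2024,
ArovasBergKivelsonRaghu2022]
#2 IsoperimetricInequality (crux) — card K1, the parameter-free ISOPERIMETRIC INEQUALITY OF PAIRING
(R_L ≥ 1 − o(1)): there is (U, δ) ∈ [2,8] × [1/10, 2/5] such that for every spectator number r and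
every ε > 0, for all large even L, every normalised (2K, 0)-sector ground state ψ of hubbardTorus 2
L 1 U has μ_{K−r}(ψ) ≤ (1+ε)^{K−r} μ_1(ψ)^{K−r} (μ_k = ‖Δ^kψ‖², Δ = pairField dWaveFormFactor L, K =
⌊(1−δ)L²/2⌋). Holds with margin for the flat AGP and for SU(2)-flat strands below half filling;
fails by (K/e²)^n for the Fermi sea. [difficulty: open-problem] (why it might fail: Given
OverlapRate it forces m = μ_1/L⁴ ≥ κ_δ e^{−4γ/(1−δ)}: stronger than S. Mean-field calibration: fails
(R_∞ < 1) for gaps 2Δ₀ ≲ 0.1t; pure-model pair densities m ≲ 10⁻³ at U ≈ 4 sit below the PBCS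
threshold m* ≈ 0.007–0.03 unless γ_true ≫ γ_PBCS.) [Coleman1965, doi:10.1090/s0273-0979-02-00941-2,
doi:10.1103/physreva.86.042317, doi:10.1103/physrev.93.99, QinEtAl2020]
#3 OverlapRate (crux) — card K2, the OVERLAP RATE of every ground state: for every (U, δ) ∈ [2,8] ×
[1/10, 2/5] there are r, γ, L₀ such that for all even L ≥ L₀ every normalised (2K, 0)-sector ground
state ψ has e^{−γL²} ‖(Δᴴ)^{K−r}|0⟩‖² ≤ μ_{K−r}(ψ) — the weight of ψ along the flat d-wave AGP
direction with r spectator pairs (μ_{K−r} = sup over unit 2r-particle χ of |⟨(Δᴴ)^{K−r}χ, ψ⟩|²) is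
not super-exponentially small in the volume. A statement of a new weak type: for
entrywise-nonnegative states it is one line (γ ≤ H(K/M)), for the attractive s-wave case it is
AttractiveSWaveOverlap. [difficulty: XL] (why it might fail: A sign statement at U > 0 with no
positivity behind it: destructive interference could make the node-avoiding fully-paired component
of a repulsive GS smaller than any e^{−γL²}; it also needs sup_L of the ground-state total spin ≤ r
on the whole window (Δ^{K−r}ψ = 0 if S > r).) [LiebPRL1989, Yang1962, Coleman1965,
doi:10.1103/physrevlett.100.080601, doi:10.1023/b:joss.0000037214.70064.78, Tasaki2020]
#9 FlatAGPNormGrowth (support) — card P2, Coleman's geminal-power norm (the volume end of the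
cascade): for every δ ∈ (0,1) and r there are κ > 0 and L₀ with (κL⁴)^n ≤ ‖(Δᴴ)^n|0⟩‖² for all L ≥
L₀, n = ⌊(1−δ)L²/2⌋ − r. Proof sketch: in momentum space Δ = √2 Σ_k ĝ_d(k) c_{k↑}c_{−k↓}, ĝ_d(k) =
2(cos k₁ − cos k₂) (momentumAnnihilation / creation_orb_eq_sum_momentumCreation of ReducedBCSTorus);
the pair creators b_k† commute and square to zero, so (Δᴴ)^n|0⟩ = 2^{n/2} n! Σ_{|S|=n} Π_{k∈S} conj
ĝ_d(k) b_k†|0⟩ and ‖·‖² = 2^n (n!)² e_n(|ĝ_d|²); bound e_n below by the product of the n largest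
|ĝ_d(k)|² (all ≥ q > 0 as soon as #{k : |ĝ_d(k)|² ≥ q} ≥ n, a lattice-point count, possible since
n/L² → (1−δ)/2 < 1) and n! ≥ (n/e)^n. [difficulty: M] [Coleman1965, doi:10.1103/physreva.86.042317,
Yang1962]
#9 PairFieldFloor (support) — hub statement, the every-ground-state L⁴ floor at one point: ∃ U > 0,
δ ∈ (0,1/2), a > 0, L₀ such that for all even L ≥ L₀ every normalised (2K, 0)-sector ground state
has a L⁴ ≤ ‖Δψ‖² (= ⟨ψ, ΔᴴΔψ⟩). It is the common output of CascadeToFloor and the input of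
FloorToSummit; as strong as the summit with a uniform constant — NOT meant for direct attack
(difficulty open-problem), filed so that the two glue supports have a shared, deduplicable decl.
[difficulty: open-problem] [Scalapino1995, ArovasBergKivelsonRaghu2022]
#9 CruxesGiveCascade (support) — IsoperimetricInequality → OverlapRate → IsoCascade: take K1's
witness (U,δ) (in the window, hence U > 0 and δ ∈ (0,1/2)), K2's (r, γ, L₀') there, K1 at that r
with ε := e − 1 (so (1+ε)^n = e^{1·n}, C := 1) and L₀ := max; pure logic, PROVED in the planner's
Sketch.lean (cruxesGiveCascade_proof, kernel-closed, 15 lines). [difficulty: provable-now]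
[Coleman1965]
#9 CascadeToFloor (support) — FlatAGPNormGrowth → IsoCascade → PairFieldFloor: at the witness and
for even L large, e^{−γL²}(κL⁴)^n ≤ μ_n ≤ e^{Cn} μ_1^n with n = K − r ≥ (1−δ)L²/4 ≥ 1, so taking
n-th roots (μ_1 ≥ 0, pow_le_pow_iff_left) μ_1 ≥ e^{−C} e^{−γ⁺L²/n} κ L⁴ ≥ e^{−C−4γ⁺/(1−δ)} κ L⁴ =: a
L⁴ with γ⁺ = max γ 0; elementary real analysis, the let-bound Φ and n of the two hypotheses are
syntactically identical after zeta-reduction. [difficulty: provable-now] [Coleman1965,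
doi:10.1103/physrevlett.100.080601]
#9 FloorToSummit (support) — PairFieldFloor → HubbardSuperconductivity: ‖Δψ‖² = re ⟨ψ, ΔᴴΔψ⟩
(star_dotProduct_conjTranspose_mul_mulVec); the k-th term of the summit's LRO sequence equals re
⟨ψ_{2k}, ΔᴴΔψ_{2k}⟩/(2k)⁴ (torusLROSeq_pairFieldCorr_succ at L+1 = 2k), is ≥ a eventually by the
floor (the summit's hypothesis at even L = 2k supplies exactly normalisation + IsGroundStateInSector
with N = 2K) and ≤ C_d² (pairFieldCorr_succ_le; normalisation at even sides suffices), so its liminf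
is ≥ a > 0 (le_liminf_of_le with isCoboundedUnder_ge_of_eventually_le); the same bookkeeping as
Theorems/WeakCouplingBCSWcbcsThesis.hasDWavePairFieldLROAt_of_forall_hasPairFieldLRO, with no odd-L
filling needed. [difficulty: provable-now] [Scalapino1995, ArovasBergKivelsonRaghu2022, Lieb1995]
#9 MaclaurinEndpoint (support) — card P1, the isoperimetric engine for the foreseen split of
IsoperimetricInequality: a positive sequence μ_0 = 1, μ_1, …, μ_n with log-concavity defect μ_k
μ_{k+2} ≤ e^c μ_{k+1}² (c ≥ 0) satisfies μ_n ≤ e^{c n(n−1)/2} μ_1^n (b_k := log μ_k − ck²/2 is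
concave with b_0 = 0, so b_n ≤ n b_1); c = 0 is Newton–Maclaurin's endpoint / Minkowski's first
inequality for the cascade, c = 2C/n gives the criterion with constant C. [difficulty: provable-now]
[doi:10.1090/s0273-0979-02-00941-2, doi:10.1103/physreva.86.042317]
#9 AttractiveSWaveOverlap (support) — card P3b, the solvable instance of OverlapRate's logical type
(where positivity lives): for U < 0, every L ≥ 1 and n, every normalised (2n, S^z = 0)-sector ground
state ψ of hubbardTorus 2 L 1 U satisfies ‖(Δ_sᴴ)^n|0⟩‖² ≤ C(L², n) · ‖Δ_s^n ψ‖², Δ_s = pairField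
sWave L = √2 Σ_x c_{x↑}c_{x↓} — i.e. the fidelity of ψ with the flat s-wave AGP is ≥ 1/C(M,n) ≥
2^{−L²}. Proof: Δ_s^n ψ is a vacuum multiple, so ‖Δ_s^nψ‖² = |⟨(Δ_sᴴ)^n 0, ψ⟩|²; (Δ_sᴴ)^n|0⟩ has the
constant coefficient (−√2)^n n! on every fully paired configuration α↑∪α↓ (site-major Jordan–Wigner
order) and 0 elsewhere; Lieb's matrix W = liebW n ψ of the (n,n)-sector ground state is definite
(lieb_core + IsLiebSystem.trichotomy: torus graph connected, t = 1 ≠ 0, U < 0) with an α-independent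
diagonal sign σ(α,α), so |Σ_α ψ(α↑∪α↓)| = |Tr W| ≥ ‖W‖_HS = ‖ψ‖ = 1 (hsInner_liebW), giving |⟨Φ,ψ⟩|²
≥ 2^n (n!)² = ‖Φ‖²/C(M,n). A literature-grade corollary of LiebPRL1989 in the genre of Tian's and
Shen's W-inequalities. [difficulty: M] [LiebPRL1989, doi:10.1023/b:joss.0000037214.70064.78,
doi:10.1142/s0217979298000442, Yang1962]

TWO-LAYER PLAN. Foreseen glued splits (none filed now): IsoperimetricInequality ⇐
CascadeNonSuperradiant (card K1′: log-concavity defect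
μ_kμ_{k+2} ≤ e^{2c/n}μ_{k+1}² along the whole cascade of every ground state at the witness point —
or, if the mean-field convex
steps of size ≤ 0.024 do not vanish with L, its AVERAGED form 'mean log pair-intensity along the
cascade ≤ the initial one +
o(1)') → MaclaurinEndpoint-instance → IsoperimetricInequality (k = 2); OverlapRate ⇐
GroundStateSpinBound (sup_L S(ψ_L) < ∞ on the
window: Δ^{K−r}ψ ≠ 0 needs a 2r-particle remainder carrying ψ's quantum numbers) →
NodeAvoidingPairedWeight (the weight of ψ on
Δ-reachable remainders is ≥ e^{−γL²}: Jensen split through one sign-matched reference AGP, card P4)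
→ OverlapRate (k = 2);
FlatAGPNormGrowth ⇐ GeminalPowerNorm (‖(Δᴴ)^n|0⟩‖² = 2^n(n!)²e_n(|ĝ_d|²), exact) → TopSymmetricMean
(lattice-point count +
Stirling) → FlatAGPNormGrowth (k = 2) if a prover wants it.

KILL CRITERIA. (i) A theorem or certified computation showing liminf_L R_L < 1, R_L :=
μ_1/μ_{K−r}^{1/(K−r)}, for ground states at EVERY
(U,δ) of the window — e.g. a d-wave reference family (Gutzwiller-projected dBCS / Jastrow-AGP at L ≥
8, VMC-sampled cascade
ratios) with R_L → 0 whose energy variance certifies ground-state proximity — refutes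
IsoperimetricInequality: close
`refuted:IsoperimetricInequality` (the ∃C form is S itself, so there is no honest pivot inside this
route). (ii) OverlapRate
refuted at one corner of the window (a ground-state family with super-exponentially small flat-AGP
weight, or unbounded
ground-state spin) while K1's natural witness lies elsewhere ⇒ repair as refuted-misstated by a new
item OverlapRateR on the
sub-window; refuted on the whole window ⇒ close `refuted:OverlapRate`. (iii) FlatAGPNormGrowth,
MaclaurinEndpoint,
AttractiveSWaveOverlap, CascadeToFloor, FloorToSummit, CruxesGiveCascade are classical mathematics /
pure logic: a Lean
refutation can only mean a misstated signature — restate, never pivot. (iv) S proved elsewhere moots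
the route; ¬S on the
whole window (route NoGo, or PureModelStripeCompetition extended to [2,8]×[1/10,2/5]) closes it.

NOT DECOMPOSED YET. The structural parent K1′ (step-by-step non-superradiance / quasi-log-concavity)
and its averaged variants; the
Jensen/reference-AGP split of OverlapRate (card P4) and the ground-state spin bound; the exact
geminal-power identity behind
FlatAGPNormGrowth; the PBCS consistency anchor (the number-projected d-wave BCS state
projectedBCSState 1 Δv μ satisfies K1 for
2Δ₀ ≳ 0.1t — card kit j001876 — a theorem about ratios of elementary symmetric polynomials, worth
filing only once a prover
asks); the hard-core-boson / sign-free version of OverlapRate (card P3a); the values of (U, δ, r,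
γ); odd L; a definition
`cascadeMoment` (signatures are let-inlined today). Constants κ_δ, m*(γ,δ) stay informal (NUMBERS).

CHEAPEST FALSIFIER. ED already run by the card (kit j001958/j001959, 4×4 torus, twisted BC): the
s-wave attractive control behaves (R_K rises
0.91 → 1.40 as U = 0 → −8; fidelity rate γ_s ≈ 0.05), the repulsive d-wave cascade has γ_d ≈ 0.6–0.7
and R ≤ 1.05 — K ≤ 6
cannot show asymptotics. The cheapest NEW kill is variational: sample the cascade ratios μ_{k+1}/μ_k
of a Gutzwiller-projected
d-wave BCS / Jastrow-AGP state at L = 8–16, δ = 0.2–0.3 (VMC; each ratio is a neighbouring-N norm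
ratio, estimable by
reweighting) — if R_L decreases with L at fixed gap, the parameter-free K1 is dead for every
realistic d-wave state; the
mean-field map (kit j001876) already says where to look: R_∞ < 1 iff 2Δ₀ ≲ 0.05–0.1t. Not run here
(compute-free hub, no kit
allowance in this plancard payload).

NUMBERS. PBCS regime map (card, kit j001876; L = 8…64): κ_L = ‖Φ_K‖^{2/K}/M² → 0.354, 0.345, 0.329,
0.304 at δ = 1/8, 0.2, 0.3, 0.4;
γ_PBCS ∈ [0.55, 1.21]; R_∞ = 0.26–0.30 (Δ₀ = 0.02), 0.83–1.06 (0.05), 1.7–2.6 (0.1), 3.0–5.2 (0.2),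
4.3–8.1 (0.4); threshold
pair density m* ≈ 0.007 (δ = 0.4) – 0.03 (δ = 1/8). ED 4×4 (j001958/9): ‖Φ_K‖² = (K!)²e_K(|ĝ|²)
numerically to 7 digits
(d, s′, s); s-wave control R_3 = 0.91/0.96/1.15/1.40 at U = 0/−2/−4/−8. Flat AGP norm here:
‖(Δᴴ)^n|0⟩‖² = 2^n(n!)²e_n(λ),
λ_k = 4(cos k₁ − cos k₂)² (the factor 2^n from pairField = √2Δ_d). Yang ceiling: μ_1 = O(L⁴).
Pure-model d-wave bond
amplitudes a ≲ 0.006 (m = 16a² ≲ 10⁻³) at U ≈ 4, δ ≈ 1/6–1/3 (QinEtAl2020, XuEtAl2024). Window of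
the cruxes: U ∈ [2,8],
δ ∈ [1/10, 2/5]. Items at open: 11 (2 cruxes, 1 target, 1 assembly, 7 supports).

DEFINITION REQUESTS. None filed: μ_k, the flat-AGP vector and the floor are inlined through
`pairField`, matrix powers, `Matrix.conjTranspose`,
`vacuum` and `star _ ⬝ᵥ _` (let-bound inside each decl; all constants checked with lean search /
lean check rc 0).
Optional later (card D1, would shorten every item): `cascadeMoment g L k ψ := ‖(pairField g L)^k
ψ‖²` and
`flatAGPNormSq g L n := ‖((pairField g L)ᴴ)^n vacuum‖²` under
Literature/MathematicalPhysics/QuantumLattice/PairCorrelations.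

Novelty: Searches (2026-08-15, this planner; local hybrid index down, searchd rc 75): `lit frontier
HubbardSuperconductivity --since 2022` (30 rows; relevant: arXiv:2601.18868 Karlsson–Hofmann–Wietek
2026, Penrose–Onsager / 2RDM-irrep diagnostics of Cooper condensation in Hubbard models —
largest-eigenvalue criteria, no operator powers, no overlap roots); `lit bridges
HubbardSuperconductivity --cross any` (30 rows, stat-mech lecture notes, nothing on AGP/cascades);
`lit search --source crossref "spin reflection positivity Hubbard ground state overlap pairing state
lower bound"` (10: doi:10.1103/physrevlett.66.3203 Singh–Scalettar 1991); `lit search --source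
crossref "Tian Lieb spin-reflection-positivity method … pairing correlation bound"` (9:
doi:10.1023/b:joss.0000037214.70064.78 Tian 2004, doi:10.1142/s0217979298000442 Shen 1998,
doi:10.1103/physrevb.54.4397 Shen 1996 — correlation inequalities from W-definiteness, the genre of
AttractiveSWaveOverlap); `lit search --source crossref "log-concavity norms of powers nilpotent
operator …"` (7, none relevant); `lit galaxy search "extreme AGP overlap ground state attractive
Hubbard" --star all` (0), `"composite boson" --star all` (16, none on ground-state cascades),
`"Maclaurin inequalit" --star panama` (8 problem books); plus the card's audited searches (crossref
×6, arXiv, galaxy ×3) and the refuter audit's reads (arXiv:1208.5985 pp. 4, 8;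
doi:10.1103/physrevlett.104.070402; doi:10.1103/physreva.71.034306; doi:10.1016/j.physrep.2007.11.  [refs: 10.1103/physrevlett.66.3203, 10.1023/b:joss.0000037214.70064.78, 10.1142/s0217979298000442, 10.1103/physrevb.54.4397, 10.1103/physrevlett.104.070402, 10.1103/physreva.71.034306, 10.1016/j.physrep.2007.11.003, 10.1103/physreva.86.042317, 10.1103/physrevlett.100.080601, 2601.18868, 1208.5985, doi:10.1103/physrevlett.66.3203, doi:10.1023/b, doi:10.1142/s0217979298000442, doi:10.1103/physrevb.54.4397,]

Barriers (technique_class: isoperimetric-cascade, overlap-large-deviation): - technique_class: isoperimetric-cascade, overlap-large-deviation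
- Literature.Barriers.HubbardSuperconductivity.GeneralizedHartreeFockNoPairing: evaded — no
quasi-free or BCS variational principle; the flat AGP enters only as a reference DIRECTION whose
overlap with the exact ground state is rooted (the Bach–Lieb–Solovej no-pairing theorem for
generalized-HF minimisers is not engaged).
- Literature.Barriers.HubbardSuperconductivity.LROForcesLowLyingStates: evaded — state-by-state
inequalities at finite L for EVERY sector ground state; degeneracy and Koma–Tasaki tower states are
absorbed by the r spectator pairs and the constants C, γ; no gap, uniqueness or symmetry-breaking
field is used.
- Literature.Barriers.HubbardSuperconductivity.PositiveTemperatureNoPairLRO: not met — T = 0 sector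
ground states only.
- Literature.Barriers.HubbardSuperconductivity.HohenbergMerminWagnerPairing: not met — no positive
temperature; consistently, in a KT phase one expects R_L ~ L^{−η} → 0 and the criterion to fail, as
it should.
- Literature.Barriers.HubbardSuperconductivity.PerturbativeInvisibilityOfPairing: not in class —
nothing is expanded in U; the line is honestly EMPTY at weak coupling (R_∞ < 1 for 2Δ₀ ≲ 0.1t),
which is why the window starts at U = 2.
- Literature.Barriers.HubbardSuperconductivity.WeakCouplingCeiling: not engaged — no weak-coupling
construction; conceded that IsoperimetricInequality fails where m ~ e^{−c/U²}.
- Literature.Barriers.HubbardSuperconductivity.StrongCoupli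

Novelty grade: new-combination — ROUTE REVIEW (refuter refuter-rreview-0815T18-15-0, 2026-08-15). VERDICT: KEEP OPEN — precise, non-vacuous, grounded, not in negatives/barriers; 11 items, one crux layer, `closes` pure logic; W2.lean rc0. NOT a recombination of closed routes (moments of ONE state vs Coleman's flat-AGP norm; no defor (refuter refuter-rreview-0815T18-15-0, 2026-08-15T19:41:15Z; prior: Coleman1965 RMP 35:668 §§3–5 (extreme AGP, geminal-power norms), Yang1962 RMP 34:694 §4 (ODLRO, pair-operator bounds), Gardner 2002 doi:10.1090/s0273-0979-02-00941-2 §§5–7 (Minkowski first / Maclaurin endpoint), Law 2005 doi:10.1103/physreva.71.034306; Combescot et al. doi:10.1016/j.physrep.2007.11.003; Tichy et al. doi:10.1103/physreva.86.042317 (composite-boson cascades χ_N = N! e_N), Zhou et al)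

History (route lifecycle, newest last):
- 2026-08-16T09:03:31Z · rev 2: restated Assembly (stmt-HubbardSuperconductivity-11989 proved) — route-repair (ground-failed): restate Assembly faithfully — hypotheses = the three mathematical inputs only (FlatAGPNormGrowth + the two cruxes), conclusion the (planner-rground-HubbardSuperconductivity-Isoper-6767d7b9-0)
- 2026-08-25T14:01:13Z · DORMANT — reconciler: no traction for 7.8 d (last activity item-evidence-added at 2026-08-17T19:16:30Z); parked, not closed — `ledger route dormant route-HubbardSupercond (operator:999:3548059)

sub-problem: HubbardSuperconductivity · status: dormant · opened planner-plancard-HubbardSuperconductivity-Hub-915cd09b-0 2026-08-15T18:47:11Z · rev 5 · ledger route-HubbardSuperconductivity-IsoperimetricCascade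
GENERATED by the gate from the ledger (D-0016/17). Provers cite these decls: `theorem foo : Summit.HubbardSuperconductivity.HubbardSuperconductivity.Theses.IsoperimetricCascade.<Decl> := …` in Summits/HubbardSuperconductivity/HubbardSuperconductivity/Theorems/<Name>.lean.
-/

namespace Summit.HubbardSuperconductivity.HubbardSuperconductivity.Theses.IsoperimetricCascade

open scoped BigOperators Topology Manifold Classical MeasureTheory ProbabilityTheory Matrix InnerProductSpace ComplexConjugate ContinuousMap
open Filter Set Function TopologicalSpace MeasureTheory

attribute [summit_statement] _root_.HubbardSuperconductivity

open Literature.Hubbard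

/-- item stmt-HubbardSuperconductivity-11979 · target · rank 0 · open · by planner
why it might fail: X1 ∧ X2 at one point is at least S with a uniform constant: pure-model (t′=0) DMRG/AFQMC at U≈4–8, δ≈1/8–1/5 find stripes and short-range d-wave pairing only; if the pure model has no d-wave LRO in (0,1/2) the target dies with S; X1 alone fails for weak pairing (2Δ₀ ≲ 0.1t, PBCS map kit j001876).
sources: Coleman1965, Yang1962, QinEtAl2020, XuEtAl2024, ArovasBergKivelsonRaghu2022
[target] X of § Thesis — at one (U, δ) with U > 0, δ ∈ (0,1/2), for some r, C, γ, L₀, every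
normalised (2K, S^z = 0)-sector ground state at even L ≥ L₀ satisfies the cascade criterion μ_n ≤
e^{Cn} μ_1^n AND the overlap rate e^{−γL²}‖(Δᴴ)^n|0⟩‖² ≤ μ_n, n = K − r (μ_k = ‖Δ^kψ‖², Δ =
pairField dWaveFormFactor L, |0⟩ = vacuum). -/
@[route_item "route-HubbardSuperconductivity-IsoperimetricCascade"]
def IsoCascade : Prop :=
  ∃ U : ℝ, 0 < U ∧ ∃ δ ∈ Set.Ioo (0:ℝ) (1/2), ∃ r : ℕ, ∃ C : ℝ, ∃ γ : ℝ, ∃ L₀ : ℕ, ∀ (L : ℕ) [NeZero L], L₀ ≤ L → Even L → ∀ ψ : Literature.MathematicalPhysics.QuantumLattice.Fock (Literature.MathematicalPhysics.QuantumLattice.Orb (Literature.MathematicalPhysics.QuantumLattice.FermionTorus 2 L)), star ψ ⬝ᵥ ψ = 1 → Literature.MathematicalPhysics.QuantumLattice.IsGroundStateInSector (Literature.MathematicalPhysics.QuantumLattice.hubbardTorus 2 L 1 U) (2 * ⌊(1 - δ) * (L : ℝ) ^ 2 / 2⌋₊) 0 ψ → let Δ := Literature.MathematicalPhysics.QuantumLattice.pairField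 Literature.MathematicalPhysics.QuantumLattice.dWaveFormFactor L; let n := ⌊(1 - δ) * (L : ℝ) ^ 2 / 2⌋₊ - r; let Φ := Δᴴ ^ n *ᵥ Literature.MathematicalPhysics.QuantumLattice.vacuum; (star (Δ ^ n *ᵥ ψ) ⬝ᵥ (Δ ^ n *ᵥ ψ)).re ≤ Real.exp (C * n) * (star (Δ *ᵥ ψ) ⬝ᵥ (Δ *ᵥ ψ)).re ^ n ∧ Real.exp (-(γ * (L : ℝ) ^ 2)) * (star Φ ⬝ᵥ Φ).re ≤ (star (Δ ^ n *ᵥ ψ) ⬝ᵥ (Δ ^ n *ᵥ ψ)).re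

/-- item stmt-HubbardSuperconductivity-11980 · crux · rank 2 · open · by planner
why it might fail: Parameter-free R_L ≥ 1−o(1) is stronger than S: with OverlapRate it forces m = μ_1/L⁴ ≥ κ_δ·e^{−4γ/(1−δ)}. PBCS calibration (card kit j001876) has R_∞ < 1 once 2Δ₀ ≲ 0.1t, and pure-model d-wave amplitudes at U≈4–8, δ≈1/8–1/3 are ≲ 0.006 with stripes dominant — below the threshold m* ≈ 0.007–0.03.
sources: Coleman1965, doi:10.1090/s0273-0979-02-00941-2, doi:10.1103/physreva.86.042317, doi:10.1103/physrevlett.104.070402, QinEtAl2020, XuEtAl2024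
[crux] card K1, the parameter-free ISOPERIMETRIC INEQUALITY OF PAIRING (R_L ≥ 1 − o(1)): there is
(U, δ) ∈ [2,8] × [1/10, 2/5] such that for every spectator number r and every ε > 0, for all large
even L, every normalised (2K, 0)-sector ground state ψ of hubbardTorus 2 L 1 U has μ_{K−r}(ψ) ≤
(1+ε)^{K−r} μ_1(ψ)^{K−r} (μ_k = ‖Δ^kψ‖², Δ = pairField dWaveFormFactor L, K = ⌊(1−δ)L²/2⌋). Holds
with margin for the flat AGP and for SU(2)-flat strands below half filling; fails by (K/e²)^n for
the Fermi sea. [difficulty: open-problem] -/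
@[route_item "route-HubbardSuperconductivity-IsoperimetricCascade", crux]
def IsoperimetricInequality : Prop :=
  ∃ U ∈ Set.Icc (2:ℝ) 8, ∃ δ ∈ Set.Icc (1/10:ℝ) (2/5), ∀ r : ℕ, ∀ ε : ℝ, 0 < ε → ∃ L₀ : ℕ, ∀ (L : ℕ) [NeZero L], L₀ ≤ L → Even L → ∀ ψ : Literature.MathematicalPhysics.QuantumLattice.Fock (Literature.MathematicalPhysics.QuantumLattice.Orb (Literature.MathematicalPhysics.QuantumLattice.FermionTorus 2 L)), star ψ ⬝ᵥ ψ = 1 → Literature.MathematicalPhysics.QuantumLattice.IsGroundStateInSector (Literature.MathematicalPhysics.QuantumLattice.hubbardTorus 2 L 1 U) (2 * ⌊(1 - δ) * (L : ℝ) ^ 2 / 2⌋₊) 0 ψ → let Δ := Literature.MathematicalPhysics.QuantumLattice.pairField Literature.MathematicalPhysics.QuantumLattice.dWaveFormFactor L; let n := ⌊(1 - δ) * (L : ℝ) ^ 2 / 2⌋₊ - r; (star (Δ ^ n *ᵥ ψ) ⬝ᵥ (Δ ^ n *ᵥ ψ)).re ≤ (1 + ε) ^ n * (star (Δ *ᵥ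 ψ) ⬝ᵥ (Δ *ᵥ ψ)).re ^ n

/-- item stmt-HubbardSuperconductivity-11981 · crux · rank 3 · open · by planner
why it might fail: No positivity at U>0 (Lieb W-definiteness needs U<0): the signed sum ⟨ρ|Δ_d^{K−r}ψ⟩ may cancel below e^{−γL²}. At U=0 it is exactly 0: the ≈0.9L nodal momenta k₁=±k₂ inside the Fermi sea are pair-occupied in every free GS, so Δ_d^{K−r}ψ=0 for r<0.9L. Needs sup_L S(ψ_L) ≤ r on the window, unproved.
sources: LiebPRL1989, Yang1962, Scalapino1995, doi:10.1103/physrevlett.100.080601, doi:10.1002/andp.19935050407, Tasaki2020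
[crux] card K2, the OVERLAP RATE of every ground state: for every (U, δ) ∈ [2,8] × [1/10, 2/5] there
are r, γ, L₀ such that for all even L ≥ L₀ every normalised (2K, 0)-sector ground state ψ has
e^{−γL²} ‖(Δᴴ)^{K−r}|0⟩‖² ≤ μ_{K−r}(ψ) — the weight of ψ along the flat d-wave AGP direction with r
spectator pairs (μ_{K−r} = sup over unit 2r-particle χ of |⟨(Δᴴ)^{K−r}χ, ψ⟩|²) is not
super-exponentially small in the volume. A statement of a new weak type: for entrywise-nonnegative
states it is one line (γ ≤ H(K/M)), for the attractive s-wave case it is AttractiveSWaveOverlap.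
[difficulty: XL] -/
@[route_item "route-HubbardSuperconductivity-IsoperimetricCascade", crux]
def OverlapRate : Prop :=
  ∀ U ∈ Set.Icc (2:ℝ) 8, ∀ δ ∈ Set.Icc (1/10:ℝ) (2/5), ∃ r : ℕ, ∃ γ : ℝ, ∃ L₀ : ℕ, ∀ (L : ℕ) [NeZero L], L₀ ≤ L → Even L → ∀ ψ : Literature.MathematicalPhysics.QuantumLattice.Fock (Literature.MathematicalPhysics.QuantumLattice.Orb (Literature.MathematicalPhysics.QuantumLattice.FermionTorus 2 L)), star ψ ⬝ᵥ ψ = 1 → Literature.MathematicalPhysics.QuantumLattice.IsGroundStateInSector (Literature.MathematicalPhysics.QuantumLattice.hubbardTorus 2 L 1 U) (2 * ⌊(1 - δ) * (L : ℝ) ^ 2 / 2⌋₊) 0 ψ → let Δ := Literature.MathematicalPhysics.QuantumLattice.pairField Literature.MathematicalPhysics.QuantumLattice.dWaveFormFactor L; let n := ⌊(1 - δ) * (L : ℝ) ^ 2 / 2⌋₊ - r; let Φ := Δᴴ ^ n *ᵥ Literature.MathematicalPhysics.QuantumLattice.vacuum; Real.exp (-(γ * (L : ℝ) ^ 2)) *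 (star Φ ⬝ᵥ Φ).re ≤ (star (Δ ^ n *ᵥ ψ) ⬝ᵥ (Δ ^ n *ᵥ ψ)).re

/-- item stmt-HubbardSuperconductivity-11982 · crux · rank 9 · closed · proved by Summit.HubbardSuperconductivity.HubbardSuperconductivity.Theorems.IsoperimetricCascade.flatAGPNormGrowth_proof @ 29524c863bf4 (prover) · by planner
why it might fail: Formal debt, not doubt: a COMPLETE sorry-free Lean proof is attached as evidence (IsoperimetricCascadeFlatAGPNormGrowth.lean, rc0 against the tree, audit proof-of-item) and only awaits a prover's propose; residual risk = a tree change to pairField/DopedRVBState before it lands.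
sources: Coleman1965, doi:10.1103/physrevb.37.3786, Yang1962
[support] card P2, Coleman's geminal-power norm (the volume end of the cascade): for every δ ∈ (0,1)
and r there are κ > 0 and L₀ with (κL⁴)^n ≤ ‖(Δᴴ)^n|0⟩‖² for all L ≥ L₀, n = ⌊(1−δ)L²/2⌋ − r. Proof
sketch: in momentum space Δ = √2 Σ_k ĝ_d(k) c_{k↑}c_{−k↓}, ĝ_d(k) = 2(cos k₁ − cos k₂)
(momentumAnnihilation / creation_orb_eq_sum_momentumCreation of ReducedBCSTorus); the pair creators
b_k† commute and square to zero, so (Δᴴ)^n|0⟩ = 2^{n/2} n! Σ_{|S|=n} Π_{k∈S} conj ĝ_d(k) b_k†|0⟩ and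
‖·‖² = 2^n (n!)² e_n(|ĝ_d|²); bound e_n below by the product of the n largest |ĝ_d(k)|² (all ≥ q > 0
as soon as #{k : |ĝ_d(k)|² ≥ q} ≥ n, a lattice-point count, possible since n/L² → (1−δ)/2 < 1) and
n! ≥ (n/e)^n. [difficulty: M] -/
@[route_item "route-HubbardSuperconductivity-IsoperimetricCascade", crux]
def FlatAGPNormGrowth : Prop :=
  ∀ δ ∈ Set.Ioo (0:ℝ) 1, ∀ r : ℕ, ∃ κ : ℝ, 0 < κ ∧ ∃ L₀ : ℕ, ∀ (L : ℕ) [NeZero L], L₀ ≤ L → let n := ⌊(1 - δ) * (L : ℝ) ^ 2 / 2⌋₊ - r; let Φ := (Literature.MathematicalPhysics.QuantumLattice.pairField Literature.MathematicalPhysics.QuantumLattice.dWaveFormFactor L)ᴴ ^ n *ᵥ Literature.MathematicalPhysics.QuantumLattice.vacuum; (κ * (L : ℝ) ^ 4) ^ n ≤ (star Φ ⬝ᵥ Φ).re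

/-- item stmt-HubbardSuperconductivity-11983 · support · rank 9 · open · by planner
sources: Scalapino1995, ArovasBergKivelsonRaghu2022
[support] hub statement, the every-ground-state L⁴ floor at one point: ∃ U > 0, δ ∈ (0,1/2), a > 0,
L₀ such that for all even L ≥ L₀ every normalised (2K, 0)-sector ground state has a L⁴ ≤ ‖Δψ‖² (=
⟨ψ, ΔᴴΔψ⟩). It is the common output of CascadeToFloor and the input of FloorToSummit; as strong as
the summit with a uniform constant — NOT meant for direct attack (difficulty open-problem), filed so
that the two glue supports have a shared, deduplicable decl. [difficulty: open-problem] -/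
@[route_item "route-HubbardSuperconductivity-IsoperimetricCascade"]
def PairFieldFloor : Prop :=
  ∃ U : ℝ, 0 < U ∧ ∃ δ ∈ Set.Ioo (0:ℝ) (1/2), ∃ a : ℝ, 0 < a ∧ ∃ L₀ : ℕ, ∀ (L : ℕ) [NeZero L], L₀ ≤ L → Even L → ∀ ψ : Literature.MathematicalPhysics.QuantumLattice.Fock (Literature.MathematicalPhysics.QuantumLattice.Orb (Literature.MathematicalPhysics.QuantumLattice.FermionTorus 2 L)), star ψ ⬝ᵥ ψ = 1 → Literature.MathematicalPhysics.QuantumLattice.IsGroundStateInSector (Literature.MathematicalPhysics.QuantumLattice.hubbardTorus 2 L 1 U) (2 * ⌊(1 - δ) * (L : ℝ) ^ 2 / 2⌋₊) 0 ψ → a * (L : ℝ) ^ 4 ≤ (star (Literature.MathematicalPhysics.QuantumLattice.pairField Literature.MathematicalPhysics.QuantumLattice.dWaveFormFactor L *ᵥ ψ) ⬝ᵥ (Literature.MathematicalPhysics.QuantumLattice.pairField Literature.MathematicalPhysics.QuantumLattice.dWaveFormFactor L *ᵥ ψ)).re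

/-- item stmt-HubbardSuperconductivity-11984 · support · rank 9 · closed · proved by Summit.HubbardSuperconductivity.HubbardSuperconductivity.Theorems.cruxesGiveCascade_proof (prover) · by planner
sources: Coleman1965
[support] IsoperimetricInequality → OverlapRate → IsoCascade: take K1's witness (U,δ) (in the
window, hence U > 0 and δ ∈ (0,1/2)), K2's (r, γ, L₀') there, K1 at that r with ε := e − 1 (so
(1+ε)^n = e^{1·n}, C := 1) and L₀ := max; pure logic, PROVED in the planner's Sketch.lean
(cruxesGiveCascade_proof, kernel-closed, 15 lines). [difficulty: provable-now] -/
@[route_item "route-HubbardSuperconductivity-IsoperimetricCascade", crux]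
def CruxesGiveCascade : Prop :=
  IsoperimetricInequality → OverlapRate → IsoCascade

/-- item stmt-HubbardSuperconductivity-11985 · support · rank 9 · closed · proved by Summit.HubbardSuperconductivity.HubbardSuperconductivity.Theorems.cascadeToFloor_proof (prover) · by planner
sources: Coleman1965, doi:10.1103/physrevlett.100.080601
[support] FlatAGPNormGrowth → IsoCascade → PairFieldFloor: at the witness and for even L large,
e^{−γL²}(κL⁴)^n ≤ μ_n ≤ e^{Cn} μ_1^n with n = K − r ≥ (1−δ)L²/4 ≥ 1, so taking n-th roots (μ_1 ≥ 0,
pow_le_pow_iff_left) μ_1 ≥ e^{−C} e^{−γ⁺L²/n} κ L⁴ ≥ e^{−C−4γ⁺/(1−δ)} κ L⁴ =: a L⁴ with γ⁺ = max γ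
0; elementary real analysis, the let-bound Φ and n of the two hypotheses are syntactically identical
after zeta-reduction. [difficulty: provable-now] -/
@[route_item "route-HubbardSuperconductivity-IsoperimetricCascade", crux]
def CascadeToFloor : Prop :=
  FlatAGPNormGrowth → IsoCascade → PairFieldFloor

/-- item stmt-HubbardSuperconductivity-11986 · support · rank 9 · closed · proved by Summit.HubbardSuperconductivity.HubbardSuperconductivity.Theorems.floorToSummit_proof (prover) · by planner
sources: Scalapino1995, ArovasBergKivelsonRaghu2022, Lieb1995
[support] PairFieldFloor → HubbardSuperconductivity: ‖Δψ‖² = re ⟨ψ, ΔᴴΔψ⟩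
(star_dotProduct_conjTranspose_mul_mulVec); the k-th term of the summit's LRO sequence equals re
⟨ψ_{2k}, ΔᴴΔψ_{2k}⟩/(2k)⁴ (torusLROSeq_pairFieldCorr_succ at L+1 = 2k), is ≥ a eventually by the
floor (the summit's hypothesis at even L = 2k supplies exactly normalisation + IsGroundStateInSector
with N = 2K) and ≤ C_d² (pairFieldCorr_succ_le; normalisation at even sides suffices), so its liminf
is ≥ a > 0 (le_liminf_of_le with isCoboundedUnder_ge_of_eventually_le); the same bookkeeping as
Theorems/WeakCouplingBCSWcbcsThesis.hasDWavePairFieldLROAt_of_forall_hasPairFieldLRO, with no odd-L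
filling needed. [difficulty: provable-now] -/
@[route_item "route-HubbardSuperconductivity-IsoperimetricCascade", crux]
def FloorToSummit : Prop :=
  PairFieldFloor → HubbardSuperconductivity

/-- item stmt-HubbardSuperconductivity-11987 · support · rank 9 · closed · proved by Summit.HubbardSuperconductivity.HubbardSuperconductivity.Theorems.maclaurinEndpoint_proof @ 43b30c00bb23 (prover) · by planner
sources: doi:10.1090/s0273-0979-02-00941-2, doi:10.1103/physreva.86.042317
[support] card P1, the isoperimetric engine for the foreseen split of IsoperimetricInequality: a
positive sequence μ_0 = 1, μ_1, …, μ_n with log-concavity defect μ_k μ_{k+2} ≤ e^c μ_{k+1}² (c ≥ 0)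
satisfies μ_n ≤ e^{c n(n−1)/2} μ_1^n (b_k := log μ_k − ck²/2 is concave with b_0 = 0, so b_n ≤ n
b_1); c = 0 is Newton–Maclaurin's endpoint / Minkowski's first inequality for the cascade, c = 2C/n
gives the criterion with constant C. [difficulty: provable-now] -/
@[route_item "route-HubbardSuperconductivity-IsoperimetricCascade"]
def MaclaurinEndpoint : Prop :=
  ∀ (μ : ℕ → ℝ) (n : ℕ) (c : ℝ), 0 ≤ c → μ 0 = 1 → (∀ k ≤ n, 0 < μ k) → (∀ k : ℕ, k + 2 ≤ n → μ k * μ (k + 2) ≤ Real.exp c * μ (k + 1) ^ 2) → μ n ≤ Real.exp (c * ((n : ℝ) * ((n : ℝ) - 1) / 2)) * μ 1 ^ n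

/-- item stmt-HubbardSuperconductivity-11988 · support · rank 9 · closed · proved by Summit.HubbardSuperconductivity.HubbardSuperconductivity.Theorems.IsoperimetricCascade.attractiveSWaveOverlap_proof @ ac35b96f041e (prover) · by planner
sources: LiebPRL1989, doi:10.1023/b:joss.0000037214.70064.78, doi:10.1142/s0217979298000442, Yang1962
[support] card P3b, the solvable instance of OverlapRate's logical type (where positivity lives):
for U < 0, every L ≥ 1 and n, every normalised (2n, S^z = 0)-sector ground state ψ of hubbardTorus 2
L 1 U satisfies ‖(Δ_sᴴ)^n|0⟩‖² ≤ C(L², n) · ‖Δ_s^n ψ‖², Δ_s = pairField sWave L = √2 Σ_x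
c_{x↑}c_{x↓} — i.e. the fidelity of ψ with the flat s-wave AGP is ≥ 1/C(M,n) ≥ 2^{−L²}. Proof: Δ_s^n
ψ is a vacuum multiple, so ‖Δ_s^nψ‖² = |⟨(Δ_sᴴ)^n 0, ψ⟩|²; (Δ_sᴴ)^n|0⟩ has the constant coefficient
(−√2)^n n! on every fully paired configuration α↑∪α↓ (site-major Jordan–Wigner order) and 0
elsewhere; Lieb's matrix W = liebW n ψ of the (n,n)-sector ground state is definite (lieb_core +
IsLiebSystem.trichotomy: torus graph connected, t = 1 ≠ 0, U < 0) with an α-independent diagonal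
sign σ(α,α), so |Σ_α ψ(α↑∪α↓)| = |Tr W| ≥ ‖W‖_HS = ‖ψ‖ = 1 (hsInner_liebW), giving |⟨Φ,ψ⟩|² ≥ 2^n
(n!)² = ‖Φ‖²/C(M,n). A literature-grade corollary of LiebPRL1989 in the genre of Tian's and Shen's
W-inequalities. [difficulty: M] -/
@[route_item "route-HubbardSuperconductivity-IsoperimetricCascade"]
def AttractiveSWaveOverlap : Prop :=
  ∀ U : ℝ, U < 0 → ∀ (L : ℕ) [NeZero L], ∀ (n : ℕ) (ψ : Literature.MathematicalPhysics.QuantumLattice.Fock (Literature.MathematicalPhysics.QuantumLattice.Orb (Literature.MathematicalPhysics.QuantumLattice.FermionTorus 2 L))), star ψ ⬝ᵥ ψ = 1 → Literature.MathematicalPhysics.QuantumLattice.IsGroundStateInSector (Literature.MathematicalPhysics.QuantumLattice.hubbardTorus 2 L 1 U) (2 * n) 0 ψ → let Δ := Literature.MathematicalPhysics.QuantumLattice.pairField Literature.MathematicalPhysics.QuantumLattice.sWave L; let Φ := Δᴴ ^ n *ᵥ Literature.MathematicalPhysics.QuantumLattice.vacuum; (star Φ ⬝ᵥ Φ).re ≤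 (Nat.choose (L ^ 2) n : ℝ) * (star (Δ ^ n *ᵥ ψ) ⬝ᵥ (Δ ^ n *ᵥ ψ)).re

-- earlier Assembly (stmt-HubbardSuperconductivity-11989, replaced 2026-08-16T09:03:31Z -> stmt-HubbardSuperconductivity-15153): proved by Summit.HubbardSuperconductivity.HubbardSuperconductivity.Theorems.isoperimetricCascade_assembly_proof — FlatAGPNormGrowth → IsoperimetricInequality → OverlapRate → CruxesGiveCascade → CascadeToFloor → FloorToSummit → HubbardSuperconductivity
/-- item stmt-HubbardSuperconductivity-15153 · assembly · rank 1 · closed · proved by Summit.HubbardSuperconductivity.HubbardSuperconductivity.Theorems.isoperimetricCascade_assembly_proof @ 1afb5317c867 (prover) · by planner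
sources: Coleman1965, Scalapino1995, doi:10.1103/physrevlett.100.080601
[assembly] the route's mathematical assembly — Coleman's geminal-power norm growth plus the two
cruxes give the summit: FlatAGPNormGrowth → IsoperimetricInequality → OverlapRate →
HubbardSuperconductivity. It is the composition FloorToSummit ∘ CascadeToFloor ∘ CruxesGiveCascade
of the three glue supports, all three landed (cruxesGiveCascade_proof and floorToSummit_proof in
Theorems/IsoperimetricCascadeGlue.lean, cascadeToFloor_proof in
Theorems/IsoperimetricCascadeCascadeToFloor.lean), hence provable-now by the one-liner `fun h₁ h₂ h₃
=> floorToSummit_proof (cascadeToFloor_proof h₁ (cruxesGiveCascade_proof h₂ h₃))` (kernel-checked in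
the planner's Sketch.lean, axioms propext/Classical.choice/Quot.sound). Restated 2026-08-16 by the
route-repair planner (ground-failed): the earlier six-binder form also listed the three glue
supports among its hypotheses and was therefore pure logic — binder for binder the type of the
deciding theorem `closes` — which the ground battery flags (ground.trivial via `intros; aesop`);
`closes` itself is unchanged and stays the certified deciding theorem. PROVER NOTE:
Theorems/IsoperimetricCascadeAssembly.lean proved the earlier form by the term `closes` an -/
@[route_item "route-HubbardSuperconductivity-IsoperimetricCascade"]
def Assembly : Prop :=
  FlatAGPNormGrowth → IsoperimetricInequality → OverlapRate → HubbardSuperconductivity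

/-! D-0027 §2.1 — DECIDING THEOREM (planner-authored via `route open/edit --closes-file`; by planner-plancard-HubbardSuperconductivity-Hub-915cd09b-0 2026-08-15T18:47:12Z):
its hypotheses are this route's items and its conclusion the sub-problem Statement (glue_lint), and it elaborates with this file. -/

@[closes "route-HubbardSuperconductivity-IsoperimetricCascade"] theorem closes (h₁ : FlatAGPNormGrowth) (h₂ : IsoperimetricInequality) (h₃ : OverlapRate) (h₄ : CruxesGiveCascade) (h₅ : CascadeToFloor) (h₆ : FloorToSummit) : HubbardSuperconductivity :=
  h₆ (h₅ h₁ (h₄ h₂ h₃))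

end Summit.HubbardSuperconductivity.HubbardSuperconductivity.Theses.IsoperimetricCascade
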